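import Summits.HubbardSuperconductivity.HubbardSuperconductivity.Theorems.ThermalWedgeTwTipContinuationEdgeOrderProductState

/-!
# `TwTipContinuation` (stmt-HubbardSuperconductivity-1700), line `isogap-submodular-transport`,
# stub `stub_edgeOrder` — piece 3b(ii): expectation values of the BCS product state

For the fixed-phase BCS product vector `Ψ = Π_k (u_k + v_k b†_k)|0⟩` over ALL Bloch pair levels of
the fermionic torus (`l = univ.toList`, normalised factors `u_k² + v_k² = 1`; calculus of the
companion file `…EdgeOrderProductState`), the textbook grand-canonical expectation values:
* `⟨n_{q↑}⟩ = ⟨n_{−q↓}⟩ = v_q²`, `⟨b†_p b_q⟩ = v_p v_q (δ_{pq} + (1−δ_{pq}) u_p u_q)`;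
* `⟨N⟩ = Σ_k 2 v_k²` and the number variance `‖NΨ − ⟨N⟩Ψ‖² = Σ_k (4v_k² − 4v_k⁴)` (independent
  pair levels);
* one-body sums `⟨Σ_{kσ} f(k) n_{kσ}⟩ = Σ_k f(k)(v_k² + v_{−k}²)`;
* the pair structure function `⟨B†B⟩` of `B = Σ_k ĝ(k) b_k` and its lower bound by the squared
  pair amplitude, `(Σ_k ĝ(k) u_k v_k)² ≤ re⟨B†B⟩`.
Bardeen–Cooper–Schrieffer 1957 §II; Leggett, *Quantum Liquids* (2006) §5.4. No definitions
(local notation for the literal product term).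
-/

noncomputable section

namespace Summit.HubbardSuperconductivity.TwTipContinuation.IsogapTransport

open Matrix Finset
open Literature.MathematicalPhysics.QuantumLattice Literature.Probability.LatticeModels
open scoped ComplexOrder ComplexConjugate

variable {L : ℕ} [NeZero L]

/-- The Bogoliubov factor `u_k + v_k b†_k` (local notation for the literal matrix term). -/
local notation "bf[" u ", " v "] " k:max =>
  (((u k : ℝ) : ℂ) • (1 : Matrix (Finset (Orb (FermionTorus 2 _))) (Finset (Orb (FermionTorus 2 _))) ℂ) +
    ((v k : ℝ) : ℂ) • (pairMode k)ᴴ)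

/-- The BCS product vector `Ψ_l = Π_{k ∈ l} (u_k + v_k b†_k) |0⟩` (local notation for the literal term). -/
local notation "Ψ[" u ", " v "] " l:max =>
  (List.prod (List.map (fun k => bf[u, v] k) l) *ᵥ (vacuum : Fock (Orb (FermionTorus 2 _))))

variable (u v : TorusSite 2 L → ℝ)

/-! ### One- and two-point functions of the product vector -/

/-- `⟨Ψ_l, n_{q↑} Ψ_l⟩ = v_q²` for `q ∈ l`. [folklore] -/
theorem expect_momentumNumber_up_prodState (huv : ∀ k, u k ^ 2 + v k ^ 2 = 1) {l : List (TorusSite 2 L)}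
    (hl : l.Nodup) {q : TorusSite 2 L} (hq : q ∈ l) :
    star (Ψ[u, v] l) ⬝ᵥ (momentumNumber q 0 *ᵥ Ψ[u, v] l) = (((v q) ^ 2 : ℝ) : ℂ) := by
  rw [momentumNumber_up_prodState_of_mem u v hl hq, dotProduct_smul, star_dotProduct_conjTranspose_mulVec,
    pairMode_prodState_of_mem u v hl hq, star_smul, smul_dotProduct,
    star_prodState_dotProduct_self u v huv (hl.erase q)]
  simp only [Complex.star_def, Complex.conj_ofReal, smul_eq_mul, mul_one]
  push_cast
  ring

/-- `⟨Ψ_l, n_{−q↓} Ψ_l⟩ = v_q²` for `q ∈ l`. [folklore] -/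
theorem expect_momentumNumber_down_prodState (huv : ∀ k, u k ^ 2 + v k ^ 2 = 1)
    {l : List (TorusSite 2 L)} (hl : l.Nodup) {q : TorusSite 2 L} (hq : q ∈ l) :
    star (Ψ[u, v] l) ⬝ᵥ (momentumNumber (-q) 1 *ᵥ Ψ[u, v] l) = (((v q) ^ 2 : ℝ) : ℂ) := by
  rw [momentumNumber_down_prodState_of_mem u v hl hq, dotProduct_smul, star_dotProduct_conjTranspose_mulVec,
    pairMode_prodState_of_mem u v hl hq, star_smul, smul_dotProduct,
    star_prodState_dotProduct_self u v huv (hl.erase q)]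
  simp only [Complex.star_def, Complex.conj_ofReal, smul_eq_mul, mul_one]
  push_cast
  ring

/-- The pair-level occupation acts as `(n_{q↑} + n_{−q↓}) Ψ_l = 2 v_q b†_q Ψ_{l∖q}` (`q ∈ l`). [folklore] -/
theorem pairLevelNumber_prodState_of_mem {l : List (TorusSite 2 L)} (hl : l.Nodup) {q : TorusSite 2 L}
    (hq : q ∈ l) :
    (momentumNumber q 0 + momentumNumber (-q) 1) *ᵥ Ψ[u, v] l =
      ((2 * v q : ℝ) : ℂ) • ((pairMode q)ᴴ *ᵥ Ψ[u, v] (l.erase q)) := by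
  rw [add_mulVec, momentumNumber_up_prodState_of_mem u v hl hq, momentumNumber_down_prodState_of_mem u v hl hq,
    ← add_smul, ← Complex.ofReal_add, ← two_mul]

/-- `⟨b_p Ψ_l, b_q Ψ_l⟩ = v_p v_q u_p u_q` for distinct `p, q ∈ l`. [folklore] -/
theorem star_pairMode_prodState_dotProduct_of_ne (huv : ∀ k, u k ^ 2 + v k ^ 2 = 1)
    {l : List (TorusSite 2 L)} (hl : l.Nodup) {p q : TorusSite 2 L} (hp : p ∈ l) (hq : q ∈ l) (hpq : p ≠ q) :
    star (pairMode p *ᵥ Ψ[u, v] l) ⬝ᵥ (pairMode q *ᵥ Ψ[u, v] l) =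
      ((v p * v q * (u p * u q) : ℝ) : ℂ) := by
  rw [pairMode_prodState_of_mem u v hl hp, pairMode_prodState_of_mem u v hl hq, star_smul, smul_dotProduct,
    dotProduct_smul, star_prodState_erase_dotProduct_prodState_erase u v huv hl hp hq hpq]
  simp only [Complex.star_def, Complex.conj_ofReal, smul_eq_mul]
  push_cast
  ring

/-- `⟨b_q Ψ_l, b_q Ψ_l⟩ = v_q²` for `q ∈ l`. [folklore] -/
theorem star_pairMode_prodState_dotProduct_self (huv : ∀ k, u k ^ 2 + v k ^ 2 = 1)
    {l : List (TorusSite 2 L)} (hl : l.Nodup) {q : TorusSite 2 L} (hq : q ∈ l) :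
    star (pairMode q *ᵥ Ψ[u, v] l) ⬝ᵥ (pairMode q *ᵥ Ψ[u, v] l) = (((v q) ^ 2 : ℝ) : ℂ) := by
  rw [pairMode_prodState_of_mem u v hl hq, star_smul, smul_dotProduct, dotProduct_smul,
    star_prodState_dotProduct_self u v huv (hl.erase q)]
  simp only [Complex.star_def, Complex.conj_ofReal, smul_eq_mul]
  push_cast
  ring

/-- `⟨b_p Ψ_l, b_q Ψ_l⟩` in closed form: `v_p v_q · (δ_{pq} + (1 − δ_{pq}) u_p u_q)`. [folklore] -/
theorem star_pairMode_prodState_dotProduct (huv : ∀ k, u k ^ 2 + v k ^ 2 = 1)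
    {l : List (TorusSite 2 L)} (hl : l.Nodup) {p q : TorusSite 2 L} (hp : p ∈ l) (hq : q ∈ l) :
    star (pairMode p *ᵥ Ψ[u, v] l) ⬝ᵥ (pairMode q *ᵥ Ψ[u, v] l) =
      ((v p * v q * (if p = q then 1 else u p * u q) : ℝ) : ℂ) := by
  by_cases hpq : p = q
  · subst hpq
    rw [if_pos rfl, star_pairMode_prodState_dotProduct_self u v huv hl hp]
    push_cast
    ring
  · rw [if_neg hpq, star_pairMode_prodState_dotProduct_of_ne u v huv hl hp hq hpq]

/-- `⟨(n_{p↑}+n_{−p↓})Ψ_l, (n_{q↑}+n_{−q↓})Ψ_l⟩ = 4 v_p² v_q²` for distinct `p, q ∈ l`. [folklore] -/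
theorem star_pairLevelNumber_dotProduct_of_ne (huv : ∀ k, u k ^ 2 + v k ^ 2 = 1)
    {l : List (TorusSite 2 L)} (hl : l.Nodup) {p q : TorusSite 2 L} (hp : p ∈ l) (hq : q ∈ l) (hpq : p ≠ q) :
    star ((momentumNumber p 0 + momentumNumber (-p) 1) *ᵥ Ψ[u, v] l) ⬝ᵥ
        ((momentumNumber q 0 + momentumNumber (-q) 1) *ᵥ Ψ[u, v] l) =
      ((4 * (v p) ^ 2 * (v q) ^ 2 : ℝ) : ℂ) := by
  have hqp : q ∈ l.erase p := (List.mem_erase_of_ne hpq.symm).2 hq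
  have hpq' : p ∈ l.erase q := (List.mem_erase_of_ne hpq).2 hp
  have hcomm : pairMode p * (pairMode q)ᴴ = (pairMode q)ᴴ * pairMode p := by
    have h := pairMode_commutator_conjTranspose p q
    rw [if_neg hpq, sub_eq_zero] at h
    exact h
  rw [pairLevelNumber_prodState_of_mem u v hl hp, pairLevelNumber_prodState_of_mem u v hl hq, star_smul,
    smul_dotProduct, dotProduct_smul, star_pairCreator_mulVec_dotProduct, mulVec_mulVec, hcomm,
    ← mulVec_mulVec, star_dotProduct_conjTranspose_mulVec, pairMode_prodState_of_mem u v (hl.erase p) hqp,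
    pairMode_prodState_of_mem u v (hl.erase q) hpq', star_smul, smul_dotProduct, dotProduct_smul,
    List.erase_comm q p, star_prodState_dotProduct_self u v huv ((hl.erase p).erase q)]
  simp only [Complex.star_def, Complex.conj_ofReal, smul_eq_mul]
  push_cast
  ring

/-- `‖(n_{q↑}+n_{−q↓})Ψ_l‖² = 4 v_q²` for `q ∈ l`. [folklore] -/
theorem star_pairLevelNumber_dotProduct_self (huv : ∀ k, u k ^ 2 + v k ^ 2 = 1)
    {l : List (TorusSite 2 L)} (hl : l.Nodup) {q : TorusSite 2 L} (hq : q ∈ l) :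
    star ((momentumNumber q 0 + momentumNumber (-q) 1) *ᵥ Ψ[u, v] l) ⬝ᵥ
        ((momentumNumber q 0 + momentumNumber (-q) 1) *ᵥ Ψ[u, v] l) = ((4 * (v q) ^ 2 : ℝ) : ℂ) := by
  have hq' : q ∉ l.erase q := hl.not_mem_erase
  rw [pairLevelNumber_prodState_of_mem u v hl hq, star_smul, smul_dotProduct, dotProduct_smul,
    star_pairCreator_mulVec_dotProduct, pairMode_pairCreator_prodState_of_not_mem u v hq',
    star_prodState_dotProduct_self u v huv (hl.erase q)]
  simp only [Complex.star_def, Complex.conj_ofReal, smul_eq_mul]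
  push_cast
  ring

/-- `⟨Ψ_l, (n_{q↑}+n_{−q↓})Ψ_l⟩ = 2 v_q²` for `q ∈ l`. [folklore] -/
theorem expect_pairLevelNumber_prodState (huv : ∀ k, u k ^ 2 + v k ^ 2 = 1)
    {l : List (TorusSite 2 L)} (hl : l.Nodup) {q : TorusSite 2 L} (hq : q ∈ l) :
    star (Ψ[u, v] l) ⬝ᵥ ((momentumNumber q 0 + momentumNumber (-q) 1) *ᵥ Ψ[u, v] l) =
      ((2 * (v q) ^ 2 : ℝ) : ℂ) := by
  rw [add_mulVec, dotProduct_add, expect_momentumNumber_up_prodState u v huv hl hq,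
    expect_momentumNumber_down_prodState u v huv hl hq]
  push_cast
  ring

/-- `⟨(n_{p↑}+n_{−p↓})Ψ_l, Ψ_l⟩ = 2 v_p²` for `p ∈ l` (the occupation is Hermitian). [folklore] -/
theorem star_pairLevelNumber_prodState_dotProduct_prodState (huv : ∀ k, u k ^ 2 + v k ^ 2 = 1)
    {l : List (TorusSite 2 L)} (hl : l.Nodup) {p : TorusSite 2 L} (hp : p ∈ l) :
    star ((momentumNumber p 0 + momentumNumber (-p) 1) *ᵥ Ψ[u, v] l) ⬝ᵥ Ψ[u, v] l =
      ((2 * (v p) ^ 2 : ℝ) : ℂ) := by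
  have hH : (momentumNumber p 0 + momentumNumber (-p) 1)ᴴ = momentumNumber p 0 + momentumNumber (-p) 1 := by
    rw [conjTranspose_add, momentumNumber_conjTranspose, momentumNumber_conjTranspose]
  have h := star_dotProduct_conjTranspose_mulVec (momentumNumber p 0 + momentumNumber (-p) 1)
    (Ψ[u, v] l) (Ψ[u, v] l)
  rw [hH] at h
  rw [← h, expect_pairLevelNumber_prodState u v huv hl hp]


/-! ### Grand-canonical expectation values of the full product state `l = univ.toList` -/

/-- `N = Σ_k (n_{k↑} + n_{−k↓})` (Parseval, and `k ↦ −k` on the down modes). [folklore] -/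
theorem totalNumber_eq_sum_pairLevelNumber :
    (totalNumber : Matrix (Finset (Orb (FermionTorus 2 L))) (Finset (Orb (FermionTorus 2 L))) ℂ) =
      ∑ k : TorusSite 2 L, (momentumNumber k 0 + momentumNumber (-k) 1) := by
  have h : ∑ k : TorusSite 2 L, momentumNumber k 1 = ∑ k : TorusSite 2 L, momentumNumber (-k) 1 :=
    (Equiv.sum_comp (Equiv.neg (TorusSite 2 L)) (fun k => momentumNumber k 1)).symm
  rw [totalNumber_eq_sum_momentumNumber]
  simp only [Fin.sum_univ_two]
  rw [Finset.sum_add_distrib, Finset.sum_add_distrib, h]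

/-- Every momentum is in `univ.toList`. [folklore] -/
theorem mem_univ_toList (k : TorusSite 2 L) : k ∈ (Finset.univ : Finset (TorusSite 2 L)).toList :=
  Finset.mem_toList.2 (Finset.mem_univ k)

/-- **Mean particle number** of the BCS product state: `⟨Ψ, N Ψ⟩ = Σ_k 2 v_k²`. [folklore] -/
theorem expect_totalNumber_prodState (huv : ∀ k, u k ^ 2 + v k ^ 2 = 1) :
    star (Ψ[u, v] (Finset.univ : Finset (TorusSite 2 L)).toList) ⬝ᵥ
        (totalNumber *ᵥ Ψ[u, v] (Finset.univ : Finset (TorusSite 2 L)).toList) =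
      ((∑ k : TorusSite 2 L, 2 * (v k) ^ 2 : ℝ) : ℂ) := by
  rw [totalNumber_eq_sum_pairLevelNumber, sum_mulVec, dotProduct_sum, Complex.ofReal_sum]
  exact Finset.sum_congr rfl fun k _ =>
    expect_pairLevelNumber_prodState u v huv (Finset.nodup_toList _) (mem_univ_toList k)

/-- **Number variance** of the BCS product state: with `N̄ = Σ_k 2v_k²`,
`‖N Ψ − N̄ Ψ‖² = Σ_k (4 v_k² − 4 v_k⁴)` (independent pair levels). [folklore] -/
theorem variance_totalNumber_prodState (huv : ∀ k, u k ^ 2 + v k ^ 2 = 1) :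
    star (totalNumber *ᵥ Ψ[u, v] (Finset.univ : Finset (TorusSite 2 L)).toList -
          ((∑ k : TorusSite 2 L, 2 * (v k) ^ 2 : ℝ) : ℂ) • Ψ[u, v] (Finset.univ : Finset (TorusSite 2 L)).toList) ⬝ᵥ
        (totalNumber *ᵥ Ψ[u, v] (Finset.univ : Finset (TorusSite 2 L)).toList -
          ((∑ k : TorusSite 2 L, 2 * (v k) ^ 2 : ℝ) : ℂ) • Ψ[u, v] (Finset.univ : Finset (TorusSite 2 L)).toList) =
      ((∑ k : TorusSite 2 L, (4 * (v k) ^ 2 - 4 * (v k) ^ 4) : ℝ) : ℂ) := by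
  set l := (Finset.univ : Finset (TorusSite 2 L)).toList with hl
  have hln : l.Nodup := Finset.nodup_toList _
  have hmem : ∀ k : TorusSite 2 L, k ∈ l := mem_univ_toList
  -- decomposition into single-level fluctuations
  have hdec : totalNumber *ᵥ Ψ[u, v] l - ((∑ k : TorusSite 2 L, 2 * (v k) ^ 2 : ℝ) : ℂ) • Ψ[u, v] l =
      ∑ k : TorusSite 2 L, ((momentumNumber k 0 + momentumNumber (-k) 1) *ᵥ Ψ[u, v] l -
        ((2 * (v k) ^ 2 : ℝ) : ℂ) • Ψ[u, v] l) := by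
    rw [Finset.sum_sub_distrib, totalNumber_eq_sum_pairLevelNumber, sum_mulVec, Complex.ofReal_sum,
      Finset.sum_smul]
  have hterm : ∀ p q : TorusSite 2 L,
      star ((momentumNumber p 0 + momentumNumber (-p) 1) *ᵥ Ψ[u, v] l - ((2 * (v p) ^ 2 : ℝ) : ℂ) • Ψ[u, v] l) ⬝ᵥ
        ((momentumNumber q 0 + momentumNumber (-q) 1) *ᵥ Ψ[u, v] l - ((2 * (v q) ^ 2 : ℝ) : ℂ) • Ψ[u, v] l) =
      if p = q then (((4 * (v q) ^ 2 - 4 * (v q) ^ 4) : ℝ) : ℂ) else 0 := by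
    intro p q
    rw [star_sub, star_smul, sub_dotProduct, dotProduct_sub, dotProduct_sub, smul_dotProduct, smul_dotProduct,
      dotProduct_smul, dotProduct_smul, star_prodState_dotProduct_self u v huv hln,
      expect_pairLevelNumber_prodState u v huv hln (hmem q),
      star_pairLevelNumber_prodState_dotProduct_prodState u v huv hln (hmem p)]
    by_cases hpq : p = q
    · subst hpq
      rw [if_pos rfl, star_pairLevelNumber_dotProduct_self u v huv hln (hmem p)]
      simp only [Complex.star_def, Complex.conj_ofReal, smul_eq_mul]
      push_cast
      ring
    · rw [if_neg hpq, star_pairLevelNumber_dotProduct_of_ne u v huv hln (hmem p) (hmem q) hpq]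
      simp only [Complex.star_def, Complex.conj_ofReal, smul_eq_mul]
      push_cast
      ring
  rw [hdec, star_sum, sum_dotProduct, Complex.ofReal_sum]
  refine Finset.sum_congr rfl fun p _ => ?_
  rw [dotProduct_sum]
  simp only [hterm, Finset.sum_ite_eq, Finset.mem_univ, if_true]

/-- **One-body expectation values**: for any real level function `f`,
`⟨Ψ, (Σ_{kσ} f(k) n_{kσ}) Ψ⟩ = Σ_k f(k) (v_k² + v_{−k}²)`. [folklore] -/
theorem expect_oneBody_prodState (huv : ∀ k, u k ^ 2 + v k ^ 2 = 1) (f : TorusSite 2 L → ℝ) :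
    star (Ψ[u, v] (Finset.univ : Finset (TorusSite 2 L)).toList) ⬝ᵥ
        ((∑ k : TorusSite 2 L, ∑ σ : Fin 2, ((f k : ℝ) : ℂ) • momentumNumber k σ) *ᵥ
          Ψ[u, v] (Finset.univ : Finset (TorusSite 2 L)).toList) =
      ((∑ k : TorusSite 2 L, f k * ((v k) ^ 2 + (v (-k)) ^ 2) : ℝ) : ℂ) := by
  have hln : ((Finset.univ : Finset (TorusSite 2 L)).toList).Nodup := Finset.nodup_toList _
  rw [sum_mulVec, dotProduct_sum, Complex.ofReal_sum]
  refine Finset.sum_congr rfl fun k _ => ?_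
  rw [Fin.sum_univ_two, add_mulVec, smul_mulVec, smul_mulVec, dotProduct_add, dotProduct_smul,
    dotProduct_smul, expect_momentumNumber_up_prodState u v huv hln (mem_univ_toList k)]
  have h := expect_momentumNumber_down_prodState u v huv hln (mem_univ_toList (-k))
  rw [neg_neg] at h
  rw [h]
  simp only [smul_eq_mul]
  push_cast
  ring

/-- `B Ψ = Σ_k ĝ(k) v_k Ψ_{l∖k}` for the pair operator `B = Σ_k ĝ(k) b_k`. [folklore] -/
theorem pairOperator_mulVec_prodState (g : TorusSite 2 L → ℝ) :
    pairOperator g Finset.univ *ᵥ Ψ[u, v] (Finset.univ : Finset (TorusSite 2 L)).toList =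
      ∑ k : TorusSite 2 L, ((g k * v k : ℝ) : ℂ) •
        Ψ[u, v] (((Finset.univ : Finset (TorusSite 2 L)).toList).erase k) := by
  rw [pairOperator, sum_mulVec]
  refine Finset.sum_congr rfl fun k _ => ?_
  rw [smul_mulVec, pairMode_prodState_of_mem u v (Finset.nodup_toList _) (mem_univ_toList k), smul_smul,
    Complex.ofReal_mul]

/-- **Pair structure function**: `⟨Ψ, B†B Ψ⟩ = Σ_{p,q} ĝ(p)ĝ(q) v_p v_q (δ_{pq} + (1−δ_{pq}) u_p u_q)`. [folklore] -/
theorem expect_pairOperator_sq_prodState (huv : ∀ k, u k ^ 2 + v k ^ 2 = 1) (g : TorusSite 2 L → ℝ) :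
    star (Ψ[u, v] (Finset.univ : Finset (TorusSite 2 L)).toList) ⬝ᵥ
        (((pairOperator g Finset.univ)ᴴ * pairOperator g Finset.univ) *ᵥ
          Ψ[u, v] (Finset.univ : Finset (TorusSite 2 L)).toList) =
      ((∑ p : TorusSite 2 L, ∑ q : TorusSite 2 L,
          g p * g q * (v p * v q * (if p = q then 1 else u p * u q)) : ℝ) : ℂ) := by
  have hln : ((Finset.univ : Finset (TorusSite 2 L)).toList).Nodup := Finset.nodup_toList _
  rw [← mulVec_mulVec, star_dotProduct_conjTranspose_mulVec, pairOperator, sum_mulVec, star_sum, sum_dotProduct,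
    Complex.ofReal_sum]
  refine Finset.sum_congr rfl fun p _ => ?_
  rw [dotProduct_sum, Complex.ofReal_sum]
  refine Finset.sum_congr rfl fun q _ => ?_
  rw [smul_mulVec, smul_mulVec, star_smul, smul_dotProduct, dotProduct_smul,
    star_pairMode_prodState_dotProduct u v huv hln (mem_univ_toList p) (mem_univ_toList q)]
  simp only [Complex.star_def, Complex.conj_ofReal, smul_eq_mul]
  push_cast
  ring

omit [NeZero L] in
/-- The positivity step `Σ_{p,q} a_p a_q (δ_{pq} + (1−δ_{pq}) u_p u_q) ≥ (Σ_p a_p u_p)²` for `u_p² ≤ 1`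
(the difference is `Σ_p a_p² (1 − u_p²)`). [folklore] -/
theorem sq_sum_le_pairSum {ι : Type*} [Fintype ι] [DecidableEq ι] (a w : ι → ℝ) (hw : ∀ k, w k ^ 2 ≤ 1) :
    (∑ p : ι, a p * w p) ^ 2 ≤ ∑ p : ι, ∑ q : ι, a p * a q * (if p = q then 1 else w p * w q) := by
  have hdiff : ∑ p : ι, ∑ q : ι, a p * a q * (if p = q then 1 else w p * w q) -
      (∑ p : ι, a p * w p) ^ 2 = ∑ p : ι, a p ^ 2 * (1 - w p ^ 2) := by
    rw [sq, Finset.sum_mul_sum, ← Finset.sum_sub_distrib]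
    refine Finset.sum_congr rfl fun p _ => ?_
    rw [← Finset.sum_sub_distrib]
    have : ∀ q, a p * a q * (if p = q then 1 else w p * w q) - a p * w p * (a q * w q) =
        if p = q then a p ^ 2 * (1 - w p ^ 2) else 0 := by
      intro q
      split_ifs with h
      · subst h; ring
      · ring
    simp only [this, Finset.sum_ite_eq, Finset.mem_univ, if_true]
  have hnn : 0 ≤ ∑ p : ι, a p ^ 2 * (1 - w p ^ 2) :=
    Finset.sum_nonneg fun p _ => mul_nonneg (sq_nonneg _) (by linarith [hw p])
  linarith

/-- **The pair amplitude bounds the pair structure function from below**: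
`(Σ_k ĝ(k) u_k v_k)² ≤ re⟨Ψ, B†B Ψ⟩` for the BCS product state (`|⟨B⟩|² ≤ ⟨B†B⟩` made explicit). [folklore] -/
theorem sq_pairAmplitude_le_expect_pairOperator_sq (huv : ∀ k, u k ^ 2 + v k ^ 2 = 1)
    (g : TorusSite 2 L → ℝ) :
    (∑ k : TorusSite 2 L, g k * u k * v k) ^ 2 ≤
      (star (Ψ[u, v] (Finset.univ : Finset (TorusSite 2 L)).toList) ⬝ᵥ
        (((pairOperator g Finset.univ)ᴴ * pairOperator g Finset.univ) *ᵥ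
          Ψ[u, v] (Finset.univ : Finset (TorusSite 2 L)).toList)).re := by
  rw [expect_pairOperator_sq_prodState u v huv g, Complex.ofReal_re]
  have hw : ∀ k, u k ^ 2 ≤ 1 := fun k => by nlinarith [huv k, sq_nonneg (v k)]
  have h := sq_sum_le_pairSum (fun k => g k * v k) u hw
  have e1 : ∑ p : TorusSite 2 L, (fun k => g k * v k) p * u p = ∑ k : TorusSite 2 L, g k * u k * v k :=
    Finset.sum_congr rfl fun k _ => by ring
  have e2 : ∑ p : TorusSite 2 L, ∑ q : TorusSite 2 L,
      (fun k => g k * v k) p * (fun k => g k * v k) q * (if p = q then 1 else u p * u q) =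
      ∑ p : TorusSite 2 L, ∑ q : TorusSite 2 L, g p * g q * (v p * v q * (if p = q then 1 else u p * u q)) :=
    Finset.sum_congr rfl fun p _ => Finset.sum_congr rfl fun q _ => by ring
  rw [e1, e2] at h
  exact h

/-! ### Spin balance -/

/-- `b†_k ψ` is spin-balanced if `ψ` is (it creates one `↑` and one `↓` electron). [folklore] -/
theorem pairCreator_mulVec_mem_spinBalanced (k : TorusSite 2 L) {ψ : Fock (Orb (FermionTorus 2 L))}
    (hψ : ψ ∈ spinBalanced) : (pairMode k)ᴴ *ᵥ ψ ∈ spinBalanced := by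
  rw [pairMode_conjTranspose, momentumCreation_eq_sum, momentumCreation_eq_sum, Finset.sum_mul_sum, sum_mulVec]
  refine Submodule.sum_mem _ fun x _ => ?_
  rw [sum_mulVec]
  refine Submodule.sum_mem _ fun y _ => ?_
  rw [smul_mul_smul_comm, smul_mulVec]
  exact Submodule.smul_mem _ _ (creation_up_mul_creation_down_mulVec_mem_spinBalanced x y hψ)

/-- Each Bogoliubov factor preserves spin balance. [folklore] -/
theorem bf_mulVec_mem_spinBalanced (k : TorusSite 2 L) {ψ : Fock (Orb (FermionTorus 2 L))}
    (hψ : ψ ∈ spinBalanced) : bf[u, v] k *ᵥ ψ ∈ spinBalanced := by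
  rw [bf_mulVec]
  exact Submodule.add_mem _ (Submodule.smul_mem _ _ hψ) (Submodule.smul_mem _ _ (pairCreator_mulVec_mem_spinBalanced k hψ))

/-- **The BCS product vector is spin-balanced** (`N↑ = N↓` on its support). [folklore] -/
theorem prodState_mem_spinBalanced (l : List (TorusSite 2 L)) : Ψ[u, v] l ∈ spinBalanced :=
  list_prod_map_mulVec_mem spinBalanced (fun k => bf[u, v] k) (fun k _ hψ => bf_mulVec_mem_spinBalanced u v k hψ)
    l vacuum vacuum_mem_spinBalanced

/-- **Mean particle number of the BCS product state (piece 3b(ii) of `stub_edgeOrder`)**, spelled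
out on the literal term: `⟨Ψ, N Ψ⟩ = Σ_k 2 v_k²` for `Ψ = Π_{k}(u_k + v_k b†_k)|0⟩` over
`univ.toList`, `u_k² + v_k² = 1`. Bardeen–Cooper–Schrieffer 1957 §II. [folklore] -/
theorem bcsProductState_expect_totalNumber :
    ∀ (L : ℕ) [NeZero L] (u v : TorusSite 2 L → ℝ), (∀ k, u k ^ 2 + v k ^ 2 = 1) → star ((List.map (fun k => ((u k : ℝ) : ℂ) • (1 : Matrix (Finset (Orb (FermionTorus 2 L))) (Finset (Orb (FermionTorus 2 L))) ℂ) + ((v k : ℝ) : ℂ) • (pairMode k)ᴴ) (Finset.univ : Finset (TorusSite 2 L)).toList).prod *ᵥ (vacuum : Fock (Orb (FermionTorus 2 L)))) ⬝ᵥ (totalNumber *ᵥ ((List.map (fun k => ((u k : ℝ) : ℂ) • (1 : Matrix (Finset (Orb (FermionTorus 2 L))) (Finset (Orb (FermionTorus 2 L))) ℂ) + ((v k : ℝ) : ℂ) • (pairMode k)ᴴ) (Finset.univ : Finset (TorusSite 2 L)).toList).prod *ᵥ (vacuum : Fock (Orb (FermionTorus 2 L))))) = ((∑ k : TorusSite 2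 L, 2 * (v k) ^ 2 : ℝ) : ℂ) :=
  fun _ _ u v huv => expect_totalNumber_prodState u v huv

end Summit.HubbardSuperconductivity.TwTipContinuation.IsogapTransport
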